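import Mathlib.AlgebraicGeometry.Morphisms.Separated
import Mathlib.AlgebraicGeometry.Morphisms.SchemeTheoreticallyDominant
import Mathlib.AlgebraicGeometry.Morphisms.Flat
import Mathlib.AlgebraicGeometry.Properties
import HarnessLib

/-!
# Morphisms to a separated scheme agreeing on a scheme-theoretically dense subscheme are equal

Topic: `Literature/AlgebraicGeometry/Limits` (the uniqueness half of the descent of group laws
through `Spec A_S = lim Spec A[1/s]` at a *fixed* stage, `Limits/LocalizationGroupSpread`).

* `ext_of_isSchemeTheoreticallyDominant_of_isSeparated` — if `f, g : X ⟶ Y` agree over a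
  separated `s : Y ⟶ Z` and after composition with a scheme-theoretically dominant `ι : W ⟶ X`,
  then `f = g` (EGA I (1971) 5.4.1 / Görtz–Wedhorn I, Prop. 9.19 with Rem. 9.20: the locus of
  coincidence `Ker(f, g)` is a closed subscheme when `Y` is separated, and a closed subscheme
  majorising a schematically dense one is everything). Mathlib's `ext_of_isDominant_of_isSeparated`
  is the variant with `ι` dominant and `X` reduced; the proof is the same (the equaliser in
  `Over Z` is a closed immersion, `isClosedImmersion_equalizer_ι_left`, and scheme-theoretically
  dominant, hence an isomorphism).
* `pullback_map_injective_of_flat` — consequently, for `i : T' ⟶ T` quasi-compact and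
  scheme-theoretically dominant, **base change along `i` is injective on `T`-morphisms `X ⟶ N`
  with `X` flat and `N` separated over `T`**: `X ×_T T' → X` is scheme-theoretically dominant
  (Mathlib `IsSchemeTheoreticallyDominant.pullbackFst`, flat base change; EGA IV₃ 11.10.5).
  With `T = Spec A`, `T' = Spec A_S` (`isSchemeTheoreticallyDominant_specMap_of_injective`) this is
  the injectivity of "restriction to the generic fibre" used to descend group laws.

## References

* A. Grothendieck, J. Dieudonné, EGA IV₃ (Publ. Math. IHÉS 28, 1966), 11.10.1–11.10.5
  (schematically dominant families, stable under flat base change). [EGAIV3]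
* U. Görtz, T. Wedhorn, *Algebraic Geometry I: Schemes*, 2nd ed. (2020), Def./Prop. 9.7–9.8,
  Prop. 9.19, Rem. 9.20 (pp. 227–234). [GortzWedhorn2020]
-/

noncomputable section

universe u

open CategoryTheory CategoryTheory.Limits AlgebraicGeometry

namespace Literature.AlgebraicGeometry.Limits

set_option backward.isDefEq.respectTransparency false

/-- If `f ≫ g` is scheme-theoretically dominant then so is `g`
(`Ker(𝒪_Z → g_*𝒪_Y) ⊆ Ker(𝒪_Z → (f ≫ g)_*𝒪_X) = 0`). [cite: GortzWedhorn2020, Rem. 9.20] -/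
theorem IsSchemeTheoreticallyDominant.of_comp_left {X Y Z : Scheme.{u}} (f : X ⟶ Y) (g : Y ⟶ Z)
    [IsSchemeTheoreticallyDominant (f ≫ g)] : IsSchemeTheoreticallyDominant g := by
  refine ⟨le_bot_iff.mp ?_⟩
  calc g.ker = Scheme.IdealSheafData.map ⊥ g := (Scheme.IdealSheafData.map_bot g).symm
    _ ≤ f.ker.map g := Scheme.IdealSheafData.map_mono g bot_le
    _ = (f ≫ g).ker := Scheme.IdealSheafData.map_ker f g
    _ = ⊥ := IsSchemeTheoreticallyDominant.ker_eq_bot _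

/-- A closed immersion which is scheme-theoretically dominant is an isomorphism
(Mathlib `IsClosedImmersion.isIso_iff_ker_eq_bot`). [cite: GortzWedhorn2020, Rem. 9.20] -/
theorem isIso_of_isClosedImmersion_of_isSchemeTheoreticallyDominant' {X Y : Scheme.{u}} (f : X ⟶ Y)
    [IsClosedImmersion f] [IsSchemeTheoreticallyDominant f] : IsIso f :=
  IsClosedImmersion.isIso_iff_ker_eq_bot.mpr (IsSchemeTheoreticallyDominant.ker_eq_bot f)

/-- **Morphisms to a separated scheme which agree on a scheme-theoretically dense subscheme are
equal.** Let `s : Y ⟶ Z` be separated, `f g : X ⟶ Y` with `f ≫ s = g ≫ s`, and `ι : W ⟶ X`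
scheme-theoretically dominant with `ι ≫ f = ι ≫ g`. Then `f = g`: the equaliser of `f` and `g` in
`Over Z` is a closed subscheme of `X` (Mathlib `isClosedImmersion_equalizer_ι_left`, `Y/Z`
separated) through which `ι` factors, hence scheme-theoretically dominant, hence all of `X`.
[cite: GortzWedhorn2020, Prop. 9.19 and Rem. 9.20] [cite: EGAIV3, 11.10.1] -/
theorem ext_of_isSchemeTheoreticallyDominant_of_isSeparated {W X Y Z : Scheme.{u}} {f g : X ⟶ Y}
    (s : Y ⟶ Z) [IsSeparated s] (h : f ≫ s = g ≫ s) (ι : W ⟶ X)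
    [IsSchemeTheoreticallyDominant ι] (hU : ι ≫ f = ι ≫ g) : f = g := by
  let X' : Over Z := Over.mk (f ≫ s)
  let Y' : Over Z := Over.mk s
  let U' : Over Z := Over.mk (ι ≫ f ≫ s)
  let f' : X' ⟶ Y' := Over.homMk f rfl
  let g' : X' ⟶ Y' := Over.homMk g h.symm
  let ι' : U' ⟶ X' := Over.homMk ι rfl
  haveI : IsSeparated Y'.hom := ‹_›
  have hfg : ι' ≫ f' = ι' ≫ g' := by
    ext : 1
    exact hU
  have hlift : (equalizer.lift ι' hfg).left ≫ (equalizer.ι f' g').left = ι := by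
    rw [← Over.comp_left, equalizer.lift_ι]
    rfl
  haveI : IsSchemeTheoreticallyDominant
      ((equalizer.lift ι' hfg).left ≫ (equalizer.ι f' g').left) := by
    rw [hlift]
    infer_instance
  haveI : IsSchemeTheoreticallyDominant (equalizer.ι f' g').left :=
    IsSchemeTheoreticallyDominant.of_comp_left (equalizer.lift ι' hfg).left _
  haveI : IsIso (equalizer.ι f' g').left :=
    isIso_of_isClosedImmersion_of_isSchemeTheoreticallyDominant' _
  rw [← cancel_epi (equalizer.ι f' g').left]
  exact congr($(equalizer.condition f' g').left)

/-- **Base change along a quasi-compact scheme-theoretically dominant morphism is injective on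
morphisms from flat to separated schemes over the base.** Let `i : T' ⟶ T` be quasi-compact and
scheme-theoretically dominant, `X → T` flat and `N → T` separated. Then `f ↦ f ×_T T'` is
injective on `Hom_T(X, N)`: `X ×_T T' → X` is scheme-theoretically dominant (flat base change,
Mathlib `IsSchemeTheoreticallyDominant.pullbackFst`; EGA IV₃ 11.10.5), and two `T`-morphisms to
the separated `N` agreeing on it are equal. [cite: EGAIV3, 11.10.5 and 11.10.1] -/
theorem pullback_map_injective_of_flat {T' T : Scheme.{u}} (i : T' ⟶ T) [QuasiCompact i]
    [IsSchemeTheoreticallyDominant i] {X N : Over T} [Flat X.hom] [IsSeparated N.hom] :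
    Function.Injective fun f : X ⟶ N => (Over.pullback i).map f := by
  intro f g hfg
  have h1 : pullback.fst X.hom i ≫ f.left = pullback.fst X.hom i ≫ g.left := by
    have e := congrArg (fun k => CommaMorphism.left k ≫ pullback.fst N.hom i) hfg
    simpa only [Over.pullback_map_left, pullback.lift_fst] using e
  ext : 1
  exact ext_of_isSchemeTheoreticallyDominant_of_isSeparated N.hom
    ((Over.w f).trans (Over.w g).symm) (pullback.fst X.hom i) h1

/-- `Spec B → Spec A` is scheme-theoretically dominant for an injective ring map `A → B` with `A`
reduced (the image is dense — `PrimeSpectrum.denseRange_comap_iff_ker_le_nilRadical` — and a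
dominant morphism to a reduced scheme is scheme-theoretically dominant); e.g. `A ⊆ B = A_S` for a
domain `A`. [cite: GortzWedhorn2020, Rem. 9.20] -/
theorem isSchemeTheoreticallyDominant_specMap_of_injective {A B : Type u} [CommRing A]
    [CommRing B] [IsReduced A] (φ : A →+* B) (hφ : Function.Injective φ) :
    IsSchemeTheoreticallyDominant (Spec.map (CommRingCat.ofHom φ)) := by
  haveI : IsDominant (Spec.map (CommRingCat.ofHom φ)) := by
    refine ⟨(PrimeSpectrum.denseRange_comap_iff_ker_le_nilRadical _).2 ?_⟩
    intro x hx
    have hx0 : x = 0 := hφ (by simpa using hx)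
    rw [hx0]
    exact zero_mem _
  haveI : IsReduced (Spec (CommRingCat.of A)) := inferInstance
  exact IsSchemeTheoreticallyDominant.of_isDominant _

end Literature.AlgebraicGeometry.Limits

end
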